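import Summits.HubbardSuperconductivity.HubbardSuperconductivity.Theses.BcsKacWindow

/-!
# Birth skeleton (BC3) — crux `CoherenceWindowLRO` (rank 2) of route `BcsKacWindow`

Crux item `stmt-HubbardSuperconductivity-1319`, decl
`Summit.HubbardSuperconductivity.HubbardSuperconductivity.Theses.BcsKacWindow.CoherenceWindowLRO`
(registered by the skeleton registrar `planner-skel-stmt-HubbardSuperconductivity-1319-0`, 2026-08-17;
route re-audit bin REPAIRABLE). The crux: a doping window `[a,b] ⊂ (0,1/2)`, a gap scale `Δ(U)`
pinned flat in `U` (`e^{-κ₂/U²} ≤ Δ(U) ≤ e^{-κ₁/U²}`), `c₀, s₀ > 0` such that for every window top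
`s ≥ s₀` there is `U₁(s) > 0` with: for `δ ∈ [a,b]`, `U ∈ (0,U₁)`, every EVEN `L` with
`s₀ ≤ Δ(U)·L ≤ s` and every normalised `(2⌊(1-δ)L²/2⌋, S^z = 0)`-sector ground state `ψ` of
`hubbardTorus 2 L 1 U`, `c₀ Δ(U)² ≤ L⁻⁴ Re⟨ψ, Δ_d† Δ_d ψ⟩` (`Δ_d†Δ_d = (pairField dWaveFormFactor L)ᴴ *
pairField dWaveFormFactor L`).

## LINE (Yang side of the coherence window: EXISTENCE of a mesoscopic condensate, then its SYMMETRY)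

The route phrases its own size-axis dichotomy in Yang's `λ_max(ρ₂)` (crux 3
`NoCondensateBelowAndersonLength`: `λ_max(ρ₂(ψ)) ≤ C` on sub-Anderson tori `L² ≤ e^{κ/U²}`; kill
criterion (ii): "`λ_max(ρ₂)/(ρΔL²)` must grow across `L_A`"). The skeleton cuts the rank-2 crux along
exactly that observable:

* `stub_windowCondensate` — THE `s ≥ s₀` HALF OF THE ANDERSON DICHOTOMY (existence of the
  condensate, any symmetry): in the coherence window every sector ground state has a macroscopic
  `ρ₂`-eigenvalue at the CONDENSATE-NUMBER scale, `λ_max(ρ₂(ψ)) ≥ c·Δ(U)·L²` (BCS: `λ_max = Σ_k u_k²v_k²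
  ≍ N(0)·Δ·L²`, the number of Cooper pairs within `Δ` of the Fermi surface; in the window
  `Δ/d_level ≍ N(0)·s·L → ∞`, so the Anderson criterion holds by a diverging margin). Typed in the
  crux's own quantifier shape (same pins, same window, `[a,b] ⊂ (0, 3/10]`), conclusion
  `c * Δ U * L² ≤ (twoParticleRDM ψ).supRayleigh`. This is NOT implied by the crux (the crux only
  forces `λ_max ≥ (c₀/4)Δ²L²` through `φ_d†ρ₂φ_d ≤ λ_max‖φ_d‖²`), and does not imply it (no symmetry).
* `stub_dWaveCoherence` — KOHN–LUTTINGER `B₁g` COHERENCE OF ANY CONDENSATE (window-free, on the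
  explicit `d_{x²-y²}` doping range `δ ∈ [0, 3/10]`, `t' = 0`): for `U ∈ (0,U₀)`, every even `L` and
  every sector ground state, the nearest-neighbour `d_{x²-y²}` pair field sees the top of `ρ₂`
  QUADRATICALLY up to an `O(L²)` background: `c₂·λ_max(ρ₂(ψ))² − C·L² ≤ Re⟨ψ, Δ_d†Δ_d ψ⟩`.
  (BCS anchor: `Re⟨Δ_d†Δ_d⟩ = m²L⁴` with `m ≍ N(0)Δ log(W/Δ)` while `λ_max ≍ N(0)ΔL²`, so
  `Re⟨Δ_d†Δ_d⟩/λ_max² ≍ log²(W/Δ) ≫ c₂`; wherever `λ_max = O(L)` — sub-Anderson tori, open Hund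
  shells (`ShellMultiplicityBound`, proved), the nested half-filled shell — the inequality is absorbed
  by `C·L²`. It fails iff some weak-coupling ground state in the range carries a macroscopic pair
  condensate NOT in the `B₁g` bond channel (`d_xy`/`p`/extended-`s`: excluded for `n ≥ 0.7` at
  `O(U²)`, Raghu–Kivelson–Scalapino 2010 Fig. 2) or a `B₁g` condensate whose bond amplitude violates
  `m ≳ λ_max/L²`.)

Neither stub shares an existential witness with the other (only the explicit range `[0,3/10]` and a
`U`-threshold taken by `min`), so the composition is honest:
`coherenceWindowLRO_of_parts` (sorry-free, ~40 lines of real arithmetic): with `c₀ := c₂c²/2` and the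
window bottom raised to `s₁ := max s₀ √(C/c₀)` (so that the background `C/L² ≤ c₀Δ²` once
`Δ(U)L ≥ s₁` — this is the crux's "c₀ uniform in s defeats the free-gas background C/L²"),
`Re⟨Δ_d†Δ_d⟩ ≥ c₂(cΔL²)² − CL² ≥ 2c₀Δ²L⁴ − c₀Δ²L⁴`. `CoherenceWindowLRO_of` = the parts lemma applied
to the two stubs; it is the only theorem concluding the crux BY NAME.

## Disproof used
none relevant: `ledger crux ls stmt-HubbardSuperconductivity-1319` shows no `Disproof.lean` / no
`Negative/` lemma for this crux at registration (2026-08-17); `ledger negatives` entries of the summit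
(XY/KLS-type) do not concern `ρ₂` or the window. The refuters' standing objection to the crux AS TYPED
(`Δ : ℝ → ℝ` doping-independent across `a < b`; repair F1 = `Δ : ℝ → ℝ → ℝ`, notes 2026-08-15) is
inherited verbatim by `stub_windowCondensate` and by nothing else: under F1 the stub's `Δ U` becomes
`Δ δ U` and `coherenceWindowLRO_of_parts` goes through unchanged.

## BC3 audit (this session, `lean check --json`)
rc 0; sorries = 2 = stubs (`stub_windowCondensate`, `stub_dWaveCoherence`), zero elsewhere; probes
`stub → CoherenceWindowLRO` and `stub → HubbardSuperconductivity` by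
`first | exact? | simpa | aesop` FAIL for both stubs (files `bc/probe_*.lean` in the registrar's folder;
results in its NOTES.md).
-/

set_option linter.dupNamespace false

namespace Summit.HubbardSuperconductivity.HubbardSuperconductivity.Cruxes.CoherenceWindowLRO.Birth

open Summit.HubbardSuperconductivity.HubbardSuperconductivity.Theses.BcsKacWindow (CoherenceWindowLRO)
open Matrix Literature.MathematicalPhysics.QuantumLattice

/-- **STUB 1 — `stub_windowCondensate` (mesoscopic condensate in the coherence window; the `s ≥ s₀`
half of the Anderson dichotomy, any pairing symmetry).** There are a doping window
`[a,b] ⊂ (0, 3/10]`, exponents `0 < κ₁ ≤ κ₂`, `c, s₀ > 0` and a gap scale `Δ : ℝ → ℝ` pinned flat in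
`U` (`e^{-κ₂/U²} ≤ Δ(U) ≤ e^{-κ₁/U²}` for `U > 0`) such that for every window top `s ≥ s₀` there is
`U₁ > 0` with: for `δ ∈ [a,b]`, `U ∈ (0,U₁)`, every even `L` with `s₀ ≤ Δ(U)·L ≤ s` and every
normalised `(2⌊(1-δ)L²/2⌋, S^z=0)`-sector ground state `ψ` of `hubbardTorus 2 L 1 U`, the largest
Rayleigh quotient of Yang's two-particle reduced density matrix is at the condensate-number scale:
`c · Δ(U) · L² ≤ λ_max(ρ₂(ψ))`.
Why plausibly true: BCS/Richardson in the regime `Δ ≫` level spacing (`Δ/d ≍ N(0)·Δ(U)L·L → ∞`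
throughout the window): `λ_max(ρ₂) = Σ_k u_k²v_k² ≍ N(0)ΔL²`; number projection and the `O(s²)`
pair-momentum modes change constants only. Fails iff the window tori carry no pair condensate for some
sector ground state (level crossing to an unpaired state) or the condensate number is `o(ΔL²)`.
Size: XL (it contains the stage above `K·Δ` and the every-ground-state control below `Δ`).
Sources: Yang 1962 §4; von Delft–Ralph 2001 §4–5; Benfatto–Giuliani–Mastropietro 2006; RKS 2010. -/
theorem stub_windowCondensate :
    ∃ (a b κ₁ κ₂ c s₀ : ℝ) (Δ : ℝ → ℝ), 0 < a ∧ a < b ∧ b ≤ 3 / 10 ∧ 0 < κ₁ ∧ κ₁ ≤ κ₂ ∧ 0 < c ∧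
      0 < s₀ ∧ (∀ U : ℝ, 0 < U → Real.exp (-(κ₂ / U ^ 2)) ≤ Δ U ∧ Δ U ≤ Real.exp (-(κ₁ / U ^ 2))) ∧
      ∀ s : ℝ, s₀ ≤ s → ∃ U₁ : ℝ, 0 < U₁ ∧ ∀ δ ∈ Set.Icc a b, ∀ U ∈ Set.Ioo (0 : ℝ) U₁,
        ∀ (L : ℕ) [NeZero L], Even L → s₀ ≤ Δ U * L → Δ U * L ≤ s →
          ∀ ψ : Fock (Orb (FermionTorus 2 L)), star ψ ⬝ᵥ ψ = 1 →
            IsGroundStateInSector (hubbardTorus 2 L 1 U) (2 * ⌊(1 - δ) * (L : ℝ) ^ 2 / 2⌋₊) 0 ψ →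
              c * Δ U * (L : ℝ) ^ 2 ≤ (twoParticleRDM ψ).supRayleigh := by
  sorry

/-- **STUB 2 — `stub_dWaveCoherence` (Kohn–Luttinger `B₁g` coherence: the nearest-neighbour
`d_{x²-y²}` pair field sees any macroscopic `ρ₂`-eigenvalue quadratically; window-free).** There are
`c₂ > 0`, `C ≥ 0`, `U₀ > 0` such that for every `δ ∈ [0, 3/10]`, `U ∈ (0,U₀)`, every even `L` and
every normalised `(2⌊(1-δ)L²/2⌋, S^z=0)`-sector ground state `ψ` of `hubbardTorus 2 L 1 U`:
`c₂ · λ_max(ρ₂(ψ))² − C · L² ≤ Re⟨ψ, Δ_d† Δ_d ψ⟩`.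
Why plausibly true: on the BCS anchor `Re⟨Δ_d†Δ_d⟩ = m²L⁴`, `m ≍ N(0)Δ log(W/Δ)`, against
`λ_max ≍ N(0)ΔL²`, ratio `log²(W/Δ) → ∞`; states with `λ_max = O(L)` (normal / sub-Anderson tori,
open Hund shells of multiplicity `≤ M₀`, the nested half-filled shell at `δ = 0`) satisfy it through
the `C·L²` slack; consistent with Yang's ceiling `Re⟨Δ_d†Δ_d⟩ ≤ 4L²·λ_max` since `λ_max ≤ N ≤ 2L²`.
Fails iff at `t' = 0`, `n ≥ 0.7`, `U → 0` some sector ground state condenses in a channel orthogonal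
to the `B₁g` bond pair (`d_xy`, `p`, extended-`s`; the `O(U²)` Kohn–Luttinger analysis puts the
first crossing near `n ≈ 0.6`) or a `B₁g` condensate has bond amplitude `m = o(λ_max/L²)`.
Size: L–XL. Sources: Raghu–Kivelson–Scalapino 2010 (Fig. 2); Scalapino 1995 §2; Yang 1962 §4;
flank item stmt-HubbardSuperconductivity-0158 (`B₁g` leading channel). -/
theorem stub_dWaveCoherence :
    ∃ c₂ C U₀ : ℝ, 0 < c₂ ∧ 0 ≤ C ∧ 0 < U₀ ∧ ∀ δ ∈ Set.Icc (0 : ℝ) (3 / 10), ∀ U ∈ Set.Ioo (0 : ℝ) U₀,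
      ∀ (L : ℕ) [NeZero L], Even L → ∀ ψ : Fock (Orb (FermionTorus 2 L)), star ψ ⬝ᵥ ψ = 1 →
        IsGroundStateInSector (hubbardTorus 2 L 1 U) (2 * ⌊(1 - δ) * (L : ℝ) ^ 2 / 2⌋₊) 0 ψ →
          c₂ * (twoParticleRDM ψ).supRayleigh ^ 2 - C * (L : ℝ) ^ 2 ≤
            (expect ((pairField dWaveFormFactor L)ᴴ * pairField dWaveFormFactor L) ψ).re := by
  sorry

/-- The elementary real-arithmetic seam: from `c Δ L² ≤ λ` (`c, Δ ≥ 0`),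
`c₂ λ² − C L² ≤ P` and the window-bottom condition `C ≤ (c₂ c²/2) (Δ L)²` one gets
`(c₂ c² / 2) Δ² L⁴ ≤ P`. [folklore] -/
theorem seam {c c₂ C Δ L lam P : ℝ} (hc : 0 ≤ c) (hc₂ : 0 ≤ c₂) (hΔ : 0 ≤ Δ)
    (hlam : c * Δ * L ^ 2 ≤ lam) (hP : c₂ * lam ^ 2 - C * L ^ 2 ≤ P)
    (hwin : C ≤ c₂ * c ^ 2 / 2 * (Δ * L) ^ 2) :
    c₂ * c ^ 2 / 2 * Δ ^ 2 * L ^ 4 ≤ P := by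
  have h0 : 0 ≤ c * Δ * L ^ 2 := by positivity
  have hsq : (c * Δ * L ^ 2) ^ 2 ≤ lam ^ 2 := pow_le_pow_left₀ h0 hlam 2
  have hsq' : c₂ * (c * Δ * L ^ 2) ^ 2 ≤ c₂ * lam ^ 2 := mul_le_mul_of_nonneg_left hsq hc₂
  have hL2 : 0 ≤ L ^ 2 := by positivity
  have hwin' : C * L ^ 2 ≤ c₂ * c ^ 2 / 2 * (Δ * L) ^ 2 * L ^ 2 :=
    mul_le_mul_of_nonneg_right hwin hL2
  nlinarith [hsq', hwin', hP]

/-- **The composition in hypotheses form (sorry-free):** the two stub STATEMENTS imply the statement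
of the crux `CoherenceWindowLRO` (its body verbatim, so that a Theses-free closing module can restate
this theorem without importing the route file). Witnesses: `a, b, κ₁, κ₂, Δ` from stub 1,
`c₀ := c₂c²/2`, window bottom `s₁ := max s₀ √(C/c₀)`, `U₁(s) := min (U₁(s) of stub 1) U₀`. -/
theorem coherenceWindowLRO_of_parts
    (h₁ : ∃ (a b κ₁ κ₂ c s₀ : ℝ) (Δ : ℝ → ℝ), 0 < a ∧ a < b ∧ b ≤ 3 / 10 ∧ 0 < κ₁ ∧ κ₁ ≤ κ₂ ∧ 0 < c ∧
      0 < s₀ ∧ (∀ U : ℝ, 0 < U → Real.exp (-(κ₂ / U ^ 2)) ≤ Δ U ∧ Δ U ≤ Real.exp (-(κ₁ / U ^ 2))) ∧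
      ∀ s : ℝ, s₀ ≤ s → ∃ U₁ : ℝ, 0 < U₁ ∧ ∀ δ ∈ Set.Icc a b, ∀ U ∈ Set.Ioo (0 : ℝ) U₁,
        ∀ (L : ℕ) [NeZero L], Even L → s₀ ≤ Δ U * L → Δ U * L ≤ s →
          ∀ ψ : Fock (Orb (FermionTorus 2 L)), star ψ ⬝ᵥ ψ = 1 →
            IsGroundStateInSector (hubbardTorus 2 L 1 U) (2 * ⌊(1 - δ) * (L : ℝ) ^ 2 / 2⌋₊) 0 ψ →
              c * Δ U * (L : ℝ) ^ 2 ≤ (twoParticleRDM ψ).supRayleigh)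
    (h₂ : ∃ c₂ C U₀ : ℝ, 0 < c₂ ∧ 0 ≤ C ∧ 0 < U₀ ∧ ∀ δ ∈ Set.Icc (0 : ℝ) (3 / 10),
      ∀ U ∈ Set.Ioo (0 : ℝ) U₀, ∀ (L : ℕ) [NeZero L], Even L →
        ∀ ψ : Fock (Orb (FermionTorus 2 L)), star ψ ⬝ᵥ ψ = 1 →
          IsGroundStateInSector (hubbardTorus 2 L 1 U) (2 * ⌊(1 - δ) * (L : ℝ) ^ 2 / 2⌋₊) 0 ψ →
            c₂ * (twoParticleRDM ψ).supRayleigh ^ 2 - C * (L : ℝ) ^ 2 ≤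
              (expect ((pairField dWaveFormFactor L)ᴴ * pairField dWaveFormFactor L) ψ).re) :
    ∃ (a b κ₁ κ₂ c₀ s₀ : ℝ) (Δ : ℝ → ℝ), 0 < a ∧ a < b ∧ b < 1 / 2 ∧ 0 < κ₁ ∧ κ₁ ≤ κ₂ ∧ 0 < c₀ ∧
      0 < s₀ ∧ (∀ U : ℝ, 0 < U → Real.exp (-(κ₂ / U ^ 2)) ≤ Δ U ∧ Δ U ≤ Real.exp (-(κ₁ / U ^ 2))) ∧
      ∀ s : ℝ, s₀ ≤ s → ∃ U₁ : ℝ, 0 < U₁ ∧ ∀ δ ∈ Set.Icc a b, ∀ U ∈ Set.Ioo (0 : ℝ) U₁,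
        ∀ (L : ℕ) [NeZero L], Even L → s₀ ≤ Δ U * L → Δ U * L ≤ s →
          ∀ ψ : Fock (Orb (FermionTorus 2 L)), star ψ ⬝ᵥ ψ = 1 →
            IsGroundStateInSector (hubbardTorus 2 L 1 U) (2 * ⌊(1 - δ) * (L : ℝ) ^ 2 / 2⌋₊) 0 ψ →
              c₀ * Δ U ^ 2 ≤
                (expect ((pairField dWaveFormFactor L)ᴴ * pairField dWaveFormFactor L) ψ).re /
                  (L : ℝ) ^ 4 := by
  obtain ⟨a, b, κ₁, κ₂, c, s₀, Δ, ha, hab, hb, hκ₁, hκ₁₂, hc, hs₀, hpin, hwin⟩ := h₁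
  obtain ⟨c₂, C, U₀, hc₂, hC, hU₀, hcoh⟩ := h₂
  -- the crux constants
  have hc₀ : 0 < c₂ * c ^ 2 / 2 := by positivity
  refine ⟨a, b, κ₁, κ₂, c₂ * c ^ 2 / 2, max s₀ (Real.sqrt (C / (c₂ * c ^ 2 / 2))), Δ, ha, hab,
    by linarith, hκ₁, hκ₁₂, hc₀, lt_of_lt_of_le hs₀ (le_max_left _ _), hpin, ?_⟩
  intro s hs
  obtain ⟨U₁, hU₁, hW⟩ := hwin s ((le_max_left _ _).trans hs)
  refine ⟨min U₁ U₀, lt_min hU₁ hU₀, ?_⟩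
  intro δ hδ U hU L _ hE hlo hhi ψ hψ hgs
  have hUpos : 0 < U := hU.1
  have hU₁' : U ∈ Set.Ioo (0 : ℝ) U₁ := ⟨hU.1, lt_of_lt_of_le hU.2 (min_le_left _ _)⟩
  have hU₀' : U ∈ Set.Ioo (0 : ℝ) U₀ := ⟨hU.1, lt_of_lt_of_le hU.2 (min_le_right _ _)⟩
  have hδ' : δ ∈ Set.Icc (0 : ℝ) (3 / 10) := ⟨by linarith [hδ.1], by linarith [hδ.2]⟩
  have hs₀L : s₀ ≤ Δ U * L := (le_max_left _ _).trans hlo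
  -- the two stubs at this ground state
  have hlam := hW δ hδ U hU₁' L hE hs₀L hhi ψ hψ hgs
  have hP := hcoh δ hδ' U hU₀' L hE ψ hψ hgs
  -- positivity of the scales
  have hΔpos : 0 < Δ U := lt_of_lt_of_le (Real.exp_pos _) (hpin U hUpos).1
  have hLpos : (0 : ℝ) < (L : ℝ) := Nat.cast_pos.mpr (Nat.pos_of_ne_zero (NeZero.ne L))
  -- the window-bottom condition: C ≤ c₀ (Δ L)²
  have hsqrt : Real.sqrt (C / (c₂ * c ^ 2 / 2)) ≤ Δ U * L := (le_max_right _ _).trans hlo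
  have hwin' : C ≤ c₂ * c ^ 2 / 2 * (Δ U * L) ^ 2 := by
    have h1 : C / (c₂ * c ^ 2 / 2) ≤ (Δ U * L) ^ 2 := by
      have h2 : Real.sqrt (C / (c₂ * c ^ 2 / 2)) ^ 2 ≤ (Δ U * L) ^ 2 :=
        pow_le_pow_left₀ (Real.sqrt_nonneg _) hsqrt 2
      rwa [Real.sq_sqrt (div_nonneg hC hc₀.le)] at h2
    rwa [div_le_iff₀' hc₀] at h1
  have key := seam hc.le hc₂.le hΔpos.le hlam hP hwin'
  rw [le_div_iff₀ (by positivity)]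
  linarith [key]

/-- **`CoherenceWindowLRO_of` — the skeleton theorem.** The two stubs imply the crux
`CoherenceWindowLRO` BY NAME (`coherenceWindowLRO_of_parts` applied to `stub_windowCondensate` and
`stub_dWaveCoherence`; `sorry` occurs only inside the two stubs). -/
theorem CoherenceWindowLRO_of : CoherenceWindowLRO :=
  coherenceWindowLRO_of_parts stub_windowCondensate stub_dWaveCoherence

end Summit.HubbardSuperconductivity.HubbardSuperconductivity.Cruxes.CoherenceWindowLRO.Birth
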